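import Literature.Computability.Complexity.GnpPlantedLikelihoodRatio
import Mathlib
import HarnessLib

/-!
# Route NegLimited — door support: FKG-lattice closure bricks for the ROUND-11 measure
(rung F-N1/p3, cell pnp-ideate)

The cover-to-correlation transfer (`NegLimitedDoorCorrelationTransfer`,
`NegLimitedDoorCorrelationNegations`) asks for a weight `μ ≥ 0` on a Boolean cube satisfying the
FKG lattice condition `μ x · μ y ≤ μ (x ⊓ y) · μ (x ⊔ y)`.  p3's ROUND-11 instance
(STATUS 2026-08-26T17:27:57Z) is the cube `β × E → Bool` (`β` = blocks, `E` = edge slots of `K_m`)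
with `μ` = a PRODUCT over the blocks of a finite MIXTURE `Σ_k w_k · G(m, p_k)` of Erdős–Rényi
weights.  This file proves that such a `μ` qualifies:

* `pow_exchange_le`, `pow_exchange_le'`, `bernoulli_pair_exchange` — the two-parameter rearrangement
  `A^i B^j + B^i A^j ≤ A^(i+j) + B^(i+j)` (`(A^i − B^i)(A^j − B^j) ≥ 0`) in Bernoulli dress;
* `fkg_bernoulliMixture` — on any finite cube `ι → Bool`, a nonnegative mixture of i.i.d.
  Bernoulli(`p_k`) weights `x ↦ Σ_k w_k p_k^{|x|} (1 − p_k)^{|ι| − |x|}` (`p_k ∈ [0,1]`) satisfies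
  the FKG lattice condition (exchangeable mixtures are log-supermodular: symmetrise the double sum
  and apply the pairwise exchange inequality; the diagonal is the modular identity of a product
  weight);
* `fkg_gnpMixture` — the same for `Σ_k w_k · gnpWeight m p_k` on the edge cube of `K_m`
  (`|E(K_m)| = C(m,2)`), with `gnpMixture_nonneg`, `sum_gnpMixture` (mass `Σ_k w_k`);
* `fkg_blockProduct`, `blockProduct_nonneg`, `sum_blockProduct` — a product over blocks `b : β` of
  an FKG-lattice weight `ν ≥ 0` on `E → Bool`, read on the cube `β × E → Bool` through the block
  restrictions `e ↦ x (b, e)`, is FKG-lattice, nonnegative, of mass `(Σ_z ν z)^{|β|}`;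
* `fkg_blockGnpMixture` — the assembled statement for p3's `μ`.

[folklore: Fortuin–Kasteleyn–Ginibre 1971 (lattice condition; products), Holley 1974; the
exchangeable-mixture computation is the Cauchy–Schwarz log-convexity of `k ↦ Σ_k w_k r_k^k`]

HONEST FRAMING: measure-theoretic bookkeeping for the door-side correlation engine; proves no
hardness; nothing here bears on P vs NP.
-/

set_option linter.dupNamespace false -- `Summit.PneNP.PneNP.…`: summit = sub-problem name (D-0017 single-conjunct layout)

namespace Summit.PneNP.PneNP.Theorems.NegLimitedDoor

open Finset
open Literature.Computability.Complexity

/-! ### The two-parameter exchange inequality -/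

/-- For `A, B ≥ 0`: `A^i B^j + B^i A^j ≤ A^(i+j) + B^(i+j)`, i.e. `(A^i − B^i)(A^j − B^j) ≥ 0`. -/
theorem pow_exchange_le {A B : ℝ} (hA : 0 ≤ A) (hB : 0 ≤ B) (i j : ℕ) :
    A ^ i * B ^ j + B ^ i * A ^ j ≤ A ^ (i + j) + B ^ (i + j) := by
  have key : 0 ≤ (A ^ i - B ^ i) * (A ^ j - B ^ j) := by
    rcases le_total A B with h | h
    · exact mul_nonneg_of_nonpos_of_nonpos (sub_nonpos.2 (pow_le_pow_left₀ hA h i))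
        (sub_nonpos.2 (pow_le_pow_left₀ hA h j))
    · exact mul_nonneg (sub_nonneg.2 (pow_le_pow_left₀ hB h i))
        (sub_nonneg.2 (pow_le_pow_left₀ hB h j))
  have e : A ^ (i + j) + B ^ (i + j) - (A ^ i * B ^ j + B ^ i * A ^ j) =
      (A ^ i - B ^ i) * (A ^ j - B ^ j) := by ring
  linarith

/-- The exchange inequality for `A = u(1−v)`, `B = (1−u)v`, powers separated. -/
theorem pow_exchange_le' {u v : ℝ} (hu0 : 0 ≤ u) (hu1 : u ≤ 1) (hv0 : 0 ≤ v) (hv1 : v ≤ 1)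
    (i j : ℕ) :
    u ^ i * (1 - v) ^ i * ((1 - u) ^ j * v ^ j) + (1 - u) ^ i * v ^ i * (u ^ j * (1 - v) ^ j) ≤
      u ^ (i + j) * (1 - v) ^ (i + j) + (1 - u) ^ (i + j) * v ^ (i + j) := by
  have hA : 0 ≤ u * (1 - v) := mul_nonneg hu0 (by linarith)
  have hB : 0 ≤ (1 - u) * v := mul_nonneg (by linarith) hv0
  have h := pow_exchange_le hA hB i j
  simp only [mul_pow] at h
  linarith

/-- **Pairwise exchange for two Bernoulli parameters `u, v ∈ [0,1]`.**  With `s` common successes,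
`c` common failures and excesses `i, j`:
`u^{s+i}(1−u)^{c+j}·v^{s+j}(1−v)^{c+i} + (u ↔ v) ≤ u^s(1−u)^{c+i+j}·v^{s+i+j}(1−v)^c + (u ↔ v)`
(factor `u^s v^s (1−u)^c (1−v)^c` times `pow_exchange_le'`). -/
theorem bernoulli_pair_exchange {u v : ℝ} (hu0 : 0 ≤ u) (hu1 : u ≤ 1) (hv0 : 0 ≤ v) (hv1 : v ≤ 1)
    (s i j c : ℕ) :
    u ^ (s + i) * (1 - u) ^ (c + j) * (v ^ (s + j) * (1 - v) ^ (c + i)) +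
        v ^ (s + i) * (1 - v) ^ (c + j) * (u ^ (s + j) * (1 - u) ^ (c + i)) ≤
      u ^ s * (1 - u) ^ (c + i + j) * (v ^ (s + i + j) * (1 - v) ^ c) +
        v ^ s * (1 - v) ^ (c + i + j) * (u ^ (s + i + j) * (1 - u) ^ c) := by
  have h := pow_exchange_le' hu0 hu1 hv0 hv1 i j
  have hK : 0 ≤ u ^ s * v ^ s * ((1 - u) ^ c * (1 - v) ^ c) :=
    mul_nonneg (mul_nonneg (pow_nonneg hu0 s) (pow_nonneg hv0 s))
      (mul_nonneg (pow_nonneg (by linarith) c) (pow_nonneg (by linarith) c))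
  have h2 := mul_le_mul_of_nonneg_left h hK
  have e1 : u ^ (s + i) * (1 - u) ^ (c + j) * (v ^ (s + j) * (1 - v) ^ (c + i)) +
        v ^ (s + i) * (1 - v) ^ (c + j) * (u ^ (s + j) * (1 - u) ^ (c + i)) =
      u ^ s * v ^ s * ((1 - u) ^ c * (1 - v) ^ c) *
        (u ^ i * (1 - v) ^ i * ((1 - u) ^ j * v ^ j) + (1 - u) ^ i * v ^ i * (u ^ j * (1 - v) ^ j)) := by
    ring
  have e2 : u ^ s * (1 - u) ^ (c + i + j) * (v ^ (s + i + j) * (1 - v) ^ c) +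
        v ^ s * (1 - v) ^ (c + i + j) * (u ^ (s + i + j) * (1 - u) ^ c) =
      u ^ s * v ^ s * ((1 - u) ^ c * (1 - v) ^ c) *
        (u ^ (i + j) * (1 - v) ^ (i + j) + (1 - u) ^ (i + j) * v ^ (i + j)) := by
    ring
  rw [e1, e2]
  exact h2

/-- Symmetrisation of a double sum: a termwise bound on `F k l + F l k` bounds `Σ_k Σ_l F k l`. -/
theorem sum_sum_le_of_symm {κ : Type*} (S : Finset κ) (F G : κ → κ → ℝ)
    (hFG : ∀ k ∈ S, ∀ l ∈ S, F k l + F l k ≤ G k l + G l k) :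
    ∑ k ∈ S, ∑ l ∈ S, F k l ≤ ∑ k ∈ S, ∑ l ∈ S, G k l := by
  have h1 : ∑ k ∈ S, ∑ l ∈ S, F l k = ∑ k ∈ S, ∑ l ∈ S, F k l := sum_comm
  have h2 : ∑ k ∈ S, ∑ l ∈ S, G l k = ∑ k ∈ S, ∑ l ∈ S, G k l := sum_comm
  have h3 : ∑ k ∈ S, ∑ l ∈ S, (F k l + F l k) ≤ ∑ k ∈ S, ∑ l ∈ S, (G k l + G l k) :=
    sum_le_sum fun k hk => sum_le_sum fun l hl => hFG k hk l hl
  simp only [sum_add_distrib] at h3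
  linarith

/-! ### Exchangeable Bernoulli mixtures on a finite cube are FKG-lattice -/

/-- **Mixtures of i.i.d. Bernoulli weights satisfy the FKG lattice condition.**  On the cube
`ι → Bool`, for weights `w_k ≥ 0` and parameters `p_k ∈ [0,1]` (`k ∈ S`), the weight
`μ x = Σ_k w_k · p_k^{|x|} (1 − p_k)^{|ι| − |x|}` (`|x| = #(onSet x)`) satisfies
`μ x · μ y ≤ μ (x ⊓ y) · μ (x ⊔ y)`. -/
theorem fkg_bernoulliMixture {ι κ : Type*} [Fintype ι] [DecidableEq ι] (S : Finset κ) (w p : κ → ℝ)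
    (hw : ∀ k ∈ S, 0 ≤ w k) (hp : ∀ k ∈ S, 0 ≤ p k ∧ p k ≤ 1) (x y : ι → Bool) :
    (∑ k ∈ S, w k * (p k ^ #(onSet x) * (1 - p k) ^ (Fintype.card ι - #(onSet x)))) *
        (∑ k ∈ S, w k * (p k ^ #(onSet y) * (1 - p k) ^ (Fintype.card ι - #(onSet y)))) ≤
      (∑ k ∈ S, w k *
          (p k ^ #(onSet (x ⊓ y)) * (1 - p k) ^ (Fintype.card ι - #(onSet (x ⊓ y))))) *
        (∑ k ∈ S, w k *
          (p k ^ #(onSet (x ⊔ y)) * (1 - p k) ^ (Fintype.card ι - #(onSet (x ⊔ y))))) := by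
  set C := Fintype.card ι with hCdef
  set a := #(onSet x) with hadef
  set b := #(onSet y) with hbdef
  set s := #(onSet (x ⊓ y)) with hsdef
  set t := #(onSet (x ⊔ y)) with htdef
  have hsa : s ≤ a := by
    rw [hsdef, hadef, onSet_inf]
    exact card_le_card inter_subset_left
  have hsb : s ≤ b := by
    rw [hsdef, hbdef, onSet_inf]
    exact card_le_card inter_subset_right
  have hst : t + s = a + b := by
    rw [htdef, hsdef, hadef, hbdef, onSet_sup, onSet_inf, card_union_add_card_inter]
  have htC : t ≤ C := card_le_univ _
  obtain ⟨i, hi⟩ := Nat.exists_eq_add_of_le hsa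
  obtain ⟨j, hj⟩ := Nat.exists_eq_add_of_le hsb
  obtain ⟨c, hc⟩ := Nat.exists_eq_add_of_le htC
  have ea : C - a = c + j := by omega
  have eb : C - b = c + i := by omega
  have es : C - s = c + i + j := by omega
  have et : C - t = c := by omega
  have ht : t = s + i + j := by omega
  rw [ea, eb, es, et, hi, hj, ht, sum_mul_sum, sum_mul_sum]
  refine sum_sum_le_of_symm S _ _ fun k hk l hl => ?_
  have h := bernoulli_pair_exchange (hp k hk).1 (hp k hk).2 (hp l hl).1 (hp l hl).2 s i j c
  have hwkl : 0 ≤ w k * w l := mul_nonneg (hw k hk) (hw l hl)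
  calc w k * (p k ^ (s + i) * (1 - p k) ^ (c + j)) * (w l * (p l ^ (s + j) * (1 - p l) ^ (c + i))) +
        w l * (p l ^ (s + i) * (1 - p l) ^ (c + j)) * (w k * (p k ^ (s + j) * (1 - p k) ^ (c + i)))
      = w k * w l * (p k ^ (s + i) * (1 - p k) ^ (c + j) * (p l ^ (s + j) * (1 - p l) ^ (c + i)) +
          p l ^ (s + i) * (1 - p l) ^ (c + j) * (p k ^ (s + j) * (1 - p k) ^ (c + i))) := by ring
    _ ≤ w k * w l * (p k ^ s * (1 - p k) ^ (c + i + j) * (p l ^ (s + i + j) * (1 - p l) ^ c) +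
          p l ^ s * (1 - p l) ^ (c + i + j) * (p k ^ (s + i + j) * (1 - p k) ^ c)) :=
        mul_le_mul_of_nonneg_left h hwkl
    _ = w k * (p k ^ s * (1 - p k) ^ (c + i + j)) * (w l * (p l ^ (s + i + j) * (1 - p l) ^ c)) +
        w l * (p l ^ s * (1 - p l) ^ (c + i + j)) * (w k * (p k ^ (s + i + j) * (1 - p k) ^ c)) := by
        ring

/-! ### Mixtures of Erdős–Rényi weights on the edge cube of `K_m` -/

/-- **A finite nonnegative mixture of `G(m, p_k)` weights (`p_k ∈ [0,1]`) satisfies the FKG lattice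
condition** on the edge cube of `K_m`. -/
theorem fkg_gnpMixture (m : ℕ) {κ : Type*} (S : Finset κ) (w p : κ → ℝ)
    (hw : ∀ k ∈ S, 0 ≤ w k) (hp : ∀ k ∈ S, 0 ≤ p k ∧ p k ≤ 1)
    (x y : (⊤ : SimpleGraph (Fin m)).edgeSet → Bool) :
    (∑ k ∈ S, w k * gnpWeight m (p k) x) * (∑ k ∈ S, w k * gnpWeight m (p k) y) ≤
      (∑ k ∈ S, w k * gnpWeight m (p k) (x ⊓ y)) * (∑ k ∈ S, w k * gnpWeight m (p k) (x ⊔ y)) := by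
  have hC : Fintype.card ((⊤ : SimpleGraph (Fin m)).edgeSet) = m.choose 2 := card_edgeSet_top_fin m
  have h := fkg_bernoulliMixture S w p hw hp x y
  rw [hC] at h
  have hE : ∀ z : (⊤ : SimpleGraph (Fin m)).edgeSet → Bool, edgeCount z = #(onSet z) := fun _ => rfl
  simp only [gnpWeight, hE]
  exact h

/-- The mixture weight is nonnegative. -/
theorem gnpMixture_nonneg (m : ℕ) {κ : Type*} (S : Finset κ) (w p : κ → ℝ)
    (hw : ∀ k ∈ S, 0 ≤ w k) (hp : ∀ k ∈ S, 0 ≤ p k ∧ p k ≤ 1)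
    (x : (⊤ : SimpleGraph (Fin m)).edgeSet → Bool) :
    0 ≤ ∑ k ∈ S, w k * gnpWeight m (p k) x :=
  sum_nonneg fun k hk => mul_nonneg (hw k hk) (gnpWeight_nonneg (hp k hk).1 (hp k hk).2 x)

/-- The mixture weight has total mass `Σ_k w_k`. -/
theorem sum_gnpMixture (m : ℕ) {κ : Type*} (S : Finset κ) (w p : κ → ℝ) :
    ∑ x : (⊤ : SimpleGraph (Fin m)).edgeSet → Bool, ∑ k ∈ S, w k * gnpWeight m (p k) x =
      ∑ k ∈ S, w k := by
  rw [sum_comm]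
  refine sum_congr rfl fun k _ => ?_
  rw [← mul_sum, sum_gnpWeight, mul_one]

/-! ### Products over blocks -/

/-- **Block products preserve the FKG lattice condition.**  If `ν ≥ 0` on `E → Bool` satisfies the
lattice condition, so does `x ↦ ∏_b ν (e ↦ x (b, e))` on the cube `β × E → Bool`. -/
theorem fkg_blockProduct {β E : Type*} [Fintype β] (ν : (E → Bool) → ℝ) (hν0 : ∀ z, 0 ≤ ν z)
    (hν : ∀ z z', ν z * ν z' ≤ ν (z ⊓ z') * ν (z ⊔ z')) (x y : β × E → Bool) :
    (∏ b, ν (fun e => x (b, e))) * (∏ b, ν (fun e => y (b, e))) ≤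
      (∏ b, ν (fun e => (x ⊓ y) (b, e))) * (∏ b, ν (fun e => (x ⊔ y) (b, e))) := by
  rw [← prod_mul_distrib, ← prod_mul_distrib]
  refine prod_le_prod (fun _ _ => mul_nonneg (hν0 _) (hν0 _)) fun b _ => ?_
  exact hν (fun e => x (b, e)) (fun e => y (b, e))

/-- The block product of a nonnegative weight is nonnegative. -/
theorem blockProduct_nonneg {β E : Type*} [Fintype β] (ν : (E → Bool) → ℝ) (hν0 : ∀ z, 0 ≤ ν z)
    (x : β × E → Bool) : 0 ≤ ∏ b, ν (fun e => x (b, e)) :=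
  prod_nonneg fun _ _ => hν0 _

/-- The block product has total mass `(Σ_z ν z)^{|β|}`. -/
theorem sum_blockProduct {β E : Type*} [Fintype β] [DecidableEq β] [Fintype E] [DecidableEq E]
    (ν : (E → Bool) → ℝ) :
    ∑ x : β × E → Bool, ∏ b, ν (fun e => x (b, e)) = (∑ z : E → Bool, ν z) ^ Fintype.card β := by
  rw [Fintype.sum_equiv (Equiv.curry β E Bool) (fun x => ∏ b, ν (fun e => x (b, e)))
    (fun g => ∏ b, ν (g b)) (fun x => rfl)]
  symm
  rw [← Finset.card_univ, ← prod_const, prod_univ_sum, Fintype.piFinset_univ]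

/-- **p3's ROUND-11 measure qualifies for the transfer.**  For blocks `b : β`, weights `w_k ≥ 0`
and densities `p_k ∈ [0,1]` (`k ∈ S`), the block product of the `G(m, ·)`-mixture,
`μ x = ∏_b Σ_k w_k · gnpWeight m p_k (e ↦ x (b, e))` on the cube `β × E(K_m) → Bool`, satisfies the
FKG lattice condition `μ x · μ y ≤ μ (x ⊓ y) · μ (x ⊔ y)`. -/
theorem fkg_blockGnpMixture {β : Type*} [Fintype β] (m : ℕ) {κ : Type*} (S : Finset κ)
    (w p : κ → ℝ) (hw : ∀ k ∈ S, 0 ≤ w k) (hp : ∀ k ∈ S, 0 ≤ p k ∧ p k ≤ 1)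
    (x y : β × (⊤ : SimpleGraph (Fin m)).edgeSet → Bool) :
    (∏ b, ∑ k ∈ S, w k * gnpWeight m (p k) (fun e => x (b, e))) *
        (∏ b, ∑ k ∈ S, w k * gnpWeight m (p k) (fun e => y (b, e))) ≤
      (∏ b, ∑ k ∈ S, w k * gnpWeight m (p k) (fun e => (x ⊓ y) (b, e))) *
        (∏ b, ∑ k ∈ S, w k * gnpWeight m (p k) (fun e => (x ⊔ y) (b, e))) :=
  fkg_blockProduct (fun z => ∑ k ∈ S, w k * gnpWeight m (p k) z)
    (gnpMixture_nonneg m S w p hw hp) (fkg_gnpMixture m S w p hw hp) x y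

end Summit.PneNP.PneNP.Theorems.NegLimitedDoor
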